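import Summits.QuantumFields.YangMills.Theorems.BalabanUVNodesN20CoreEdgeShellDialAtKeyReading
import Summits.QuantumFields.YangMills.Theorems.BalabanUVNodesK3V6Defs
import Summits.QuantumFields.YangMills.Theorems.BalabanUVNodesSpineReadingOfRecord13CoPHVSlot
import Summits.QuantumFields.YangMills.Theorems.BalabanUVNodesN27BudgetRedundant

/-!
# BalabanUVNodes ∕ N20·N21·N19′ — module 13X: THE KEY-READING ROAD UNDER THE ITEM'S OWN PREFIX.  K3⁸ `Theses.BalabanUVNodes.SpineGivenEndpointR13SepCoPHV` IS, per slot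
# tuple, «(B) → END → `ForSmallCouplings (datumOfRecord₁₃SepCoPHV F 2 θ h v) (g₀ ↦ ∀ os, StringHybridNE7 …)`» with the carriers EXISTENTIAL (`T4ApexHybrid.HybridNE7Under`); so
# the faces ∕ certificate ∕ letters AT THE `kr`-COARSE CARRIERS of dag-n20-d's key-reading edition need hold ONLY INSIDE THE TUNING WINDOW of each slot datum, (B) and END in
# hand, with NO K4 face and NO `W + Wsh < 1` row (dag-n27-a's `hybridNE7Under_of_spineNodes_tail`) — the sharpest (weakest-hypothesis) form of modules 13V ∕ 13W

Cell `pub-ymgap` (HUMAN RULING D-0062 Track A; D-0149 width push), seat `pub-ymgap-dag-n20-w3` (WIDTH SEAT 3 of 3 on NODE n20 = NE7b) gen 9, CLAIM-3 ∕ INTENT-3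
(pub-ymgap INBOX l.39592).  Filed `--kind proof --supports stmt-QuantumFields-27366 --as helper` (K3⁸, skeleton v6 b4e55110ab73e679; dag-lead KEY MAP v2).  COUNT-NEUTRAL.
ADDITIVE — imports this lineage's module 13K `…N20CoreEdgeShellDialAtKeyReading` (p615422: `weightAK₁₃_nonneg_record ∕ weightBK₁₃_nonneg_record`; through it module 13
`…N20CoreEdgeShellDial` p608626 — `shellWeightBound_optShell`, `core_optShell_zero` — and dag-n20-d's K edition p608328), dag-n27-w1's mirror `…K3V6Defs` (p625739: `K3V5Defs.LiveSel`
and the route decl's `Iff.rfl` bridge), dag-n20-d's `…SpineReadingOfRecord13CoPHVSlot` v1.1 (p637963: `keyedExtraction_crOfRecord₁₃KAt_slot_abs` — E1 ∕ E2 AT THE SLOT DATUM under the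
prefix, from `LiveSel ∧ ZetaMeasurable`) and dag-n27-a's `…N27BudgetRedundant` (`hybridNE7Under_of_spineNodes_tail`: B5 from the four reading-level faces + E1 ∕ E2 under the prefix, the
budget row `W + Wsh < 1` REDUNDANT by a tail shift) — all BY NAME; modifies nothing.  Inside the theses cone (via `K3V5Defs`) like 13b ∕ 13R ∕ 13T ∕ 13U ∕ 13V ∕ 13W.
[LF-II] = [Balaban1989LargeFieldII], [I] = [Balaban1987RG1], [King1986] = CMP 102 (locations only).

WHY.  Modules 13V (p640068) and 13W (p641167) reach the item through dag-n27-w1's `spineGivenEndpointR13SepCoPHV_of_facesV`, i.e. through v6's five FACE TEXTS.  Two of those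
texts, N20 `KeyedRelWeight cr` and N21 `KeyedShellWeight cr` (v5 l.315 ∕ l.321), are PREFIX-FREE: they ask `RelWeightBound` ∕ `ShellWeightBound` at EVERY bare sequence
`g₀ : ℕ → ℝ` and every loop list `os`, for every guarded admissible tuple — outside any `ForSmallCouplings`, whereas every analytic supplier (Bałaban-side or caricature) lives in the
tuning window of [I] Thm 2 p.259; and the N19′ text is conditioned on K4's `PHolderD4`, so K4 is displayed even by roads that never read the rates.  The ITEM asks less: by
`T4ApexHybrid.HybridNE7Under`'s definition (`FiniteEpsData.UnderHypotheses`, `StringwiseHybridNE7`, `StringHybridNE7` — carriers, radius, volume, offset ALL existential per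
`(g₀, os)`), K3⁸ is «per slot tuple: (B) → END → ForSmallCouplings (slot datum) (g₀ ↦ ∀ os, ∃ carriers, HybridNE7 ∧ E1 ∧ E2)», and dag-n27-a's `hybridNE7Under_of_spineNodes_tail`
accepts the four faces WITHOUT the budget row.  THIS FILE reads the key-reading road in exactly that currency, at the `kr`-coarse carriers `(classSetK₁₃, weightAK₁₃, weightBK₁₃)`
(`l₀ := 1`, `vol := F.side⁴`, `K₀ := 0`), E1 ∕ E2 there being dag-n20-d's theorem under the prefix on the keyed live line:
* §1 ★★★ `spineGivenEndpointR13SepCoPHV_of_liveLine_of_fscFacesK` — K3⁸ BY NAME ⇐ keyed live line + per slot tuple `(F, θ, h, v)` under guard ∕ `Admissible` ∕ (B) ∕ END: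
  `ForSmallCouplings (datumOfRecord₁₃SepCoPHV F 2 θ h v) (g₀ ↦ ∀ os, ∃ Bad W shA shB Wsh δ, RelWeightBound … Bad W ∧ ShellWeightBound … shA shB Wsh ∧ NE7.Core … Bad (A − shA)
  (B − shB) δ ∧ Summable δ)` at the `kr`-coarse carriers — ANY key reading, ANY bad class, ANY shells, NO budget row, NO K4, letters only in the window.
* §2 ★★ `…_of_liveLine_of_fscKeyedHybridNE7K` (a `HybridNE7` certificate there, its four fields projected) · ★★★ `…_of_liveLine_of_fscL1LetterK` (the ONE ℓ¹ class-matching letter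
  of 13V, now asked only in the window: optimal shells by module 13's `shellWeightBound_optShell` ∕ `core_optShell_zero`, empty bad class) · ★★ `…_of_liveLine_of_fscCoreLetterK_of_relWeightBoundK`
  (13W §3's (YGₖᵣ)+(ACₖᵣ) pair, now in the window: the tree's `hybridNE7_noShell`).
LOCATED (said, not decided; for plan ∕ CRIT-1): (a) v6's N20 ∕ N21 face texts over-ask relative to the item by exactly the missing prefix — a v7 could key N20 ∕ N21 under the same
`(B) → END → ForSmallCouplings` as N19′ ∕ N27x at no cost to the composition; (b) K4 (`stub_rates13HV`) is needed by the N19′ roads that READ the rates (Bałaban's), not by the item: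
a letter ∕ certificate road at any key reading closes K3⁸ from the keyed live line alone.  The item-level endpoint «B5 ⟺ MatchingUnder at the slot datum» is dag-n19-d's
(`hybridNE7Under_iff_matchingUnder_of_isRecordOfRecord₁₃C…`, dag-n23-b's `T4MatchingDegenerate`) — this file stays on the hybrid side and restates nothing of it.

HONEST FRAMING.  By-name plumbing over the tree's SHAPES; proves NO estimate; the window-keyed faces ∕ certificate ∕ letters are the two-run content at a coarse key — NOT PRINTED for
`d = 4`, produced by nobody, inhabited for no Bałaban family today (K0⁷ `Record13SepCoPHInhabited` OPEN); the live line is a HYPOTHESIS; NOT a proof of `stub_expansion13HV` nor of K3⁸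
(the theorems conclude the decl BY NAME from DISPLAYED hypotheses — `proof.conditional`, credits nothing); nothing of Bałaban's asserted; NE7 ∕ NE7b ∕ NE7c NOT PROVED; N19 ∕ N20 ∕ N21 ∕
N27x NOT discharged; K3⁸ OPEN, v6 STANDS, not claimed; counts unmoved (typed 28∕28 · discharged 5∕27); no count claim.  One finite `𝕋⁴_{L^K}` programme at fixed `ε = L^{−K}`, Bałaban
AS PRINTED — R4 closes the conditional finite-𝕋⁴ rung `BalabanLadder.UV` only; the YM mass gap (Clay) is NOT proved by any of this; NOT ℝ⁴, NOT continuum, NOT OS.  No `def`, no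
`instance`, no `notation`, no `sorry`, no private decls.  Sources (location only): [I] Thm 2 p.259 (the tuning window); [King1986] (3.10)–(3.13) pp.656–657; [LF-II] (1.80) p.384.
-/

noncomputable section

open Finset
open scoped BigOperators

namespace Summit.QuantumFields.YangMills.BalabanUVNodes.N20KeyReadingRoadUnderPrefix

open Literature.MathematicalPhysics.QuantumFieldTheory.Balaban1983to89
open Literature.MathematicalPhysics.QuantumFieldTheory.Balaban1983to89.T4Continuum
open Literature.MathematicalPhysics.QuantumFieldTheory.Balaban1983to89.Node00
open T4WeightBudget (RelWeightBound)
open T4IndicatorShell (ShellWeightBound)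
open T4ContinuumYM4Torus (ForSmallCouplings)
open T4MatchingAssembly (HybridNE7 hybridNE7_noShell)
open Summit.QuantumFields.BalabanUV.T4Continuum.Spine
open YMDAG.UVSplit hiding SU
open Summit.QuantumFields.YangMills.Theorems.K3V5Defs (LiveSel)
open Summit.QuantumFields.YangMills.BalabanUVNodes.N20CoreEdgeShellDial (shellWeightBound_optShell core_optShell_zero)
open Summit.QuantumFields.YangMills.BalabanUVNodes.N20CoreEdgeShellDialAtKeyReading (weightAK₁₃_nonneg_record weightBK₁₃_nonneg_record)
open Summit.QuantumFields.YangMills.Theorems.BalabanUVNodesN27SpineRecord (hybridNE7Under_of_spineNodes_tail)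

variable (kr : KeyReading₁₃ 2 0)

/-! ## §1 The socket: the four reading-level faces AT the `kr`-coarse carriers, INSIDE THE WINDOW of each slot datum, (B) and END in hand — no budget row, no K4 -/

section Socket

/-- **★★★ K3⁸ BY NAME FROM THE KEYED LIVE LINE AND THE FOUR READING-LEVEL FACES AT THE `kr`-COARSE CARRIERS, ASKED ONLY UNDER THE ITEM's OWN PREFIX.**  Hypotheses: `hlive` the
keyed live line (E1 ∕ E2 at every key reading, dag-n20-d); `hF`: for every slot tuple `(F, θ, h, v)` passing the guard and `Admissible`, GIVEN (B) and END at the slot datum, INSIDE ITS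
TUNING WINDOW (`ForSmallCouplings`), for every `os`: SOME bad class, weight, shells, shell weight and rate with `RelWeightBound ∧ ShellWeightBound ∧ NE7.Core ∧ Summable` at
`(1, F.side⁴, classSetK₁₃ θ 0 g₀ (kr …), weightAK₁₃ …, weightBK₁₃ …)`.  Conclusion: `SpineGivenEndpointR13SepCoPHV` — per slot tuple, dag-n27-a's `hybridNE7Under_of_spineNodes_tail`
on `hF ∧ E1∕E2` (`ForSmallCouplings.and`); NO `W + Wsh < 1` row (tail shift), NO K4, NO ∀-`g₀`.  Every face is the two-run CONTENT at the coarse key — a HYPOTHESIS; NOT a proof of K3⁸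
(`proof.conditional`). [cite: Balaban1987RG1, Thm 2 p.259 (the tuning window; template only)] [bookkeeping] -/
theorem spineGivenEndpointR13SepCoPHV_of_liveLine_of_fscFacesK
    (hlive : ∀ (F : T4Family) (θ : Stage13HParams F 2), θ.Provisos₁₃CoPH F 2 → (θ.ZhUnity F 2 ∧ θ.SlotsNondegenerate₁₃ F 2) → θ.Admissible F 2 →
      LiveSel F θ ∧ ZetaMeasurable F 2 θ.ζ)
    (hF : ∀ (F : T4Family) (θ : Stage13HParams F 2) (h : θ.Provisos₁₃SepCoPH F 2) (v : Revision₁₃ F 2 θ h), (θ.ZhUnity F 2 ∧ θ.SlotsNondegenerate₁₃ F 2) → θ.Admissible F 2 →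
      B16.EndStatementBPrinted (datumOfRecord₁₃SepCoPHV F 2 θ h v).C → DagBinding.EndpointExistence (datumOfRecord₁₃SepCoPHV F 2 θ h v).C.toB12 →
        ForSmallCouplings (datumOfRecord₁₃SepCoPHV F 2 θ h v) fun g₀ => ∀ os : List (ULoop F),
          letI : DecidableEq (Σ K, SiteSeqKey F (0 + K)) := Classical.decEq _
          ∃ (Bad : ℕ → ℝ → Finset (Σ K, SiteSeqKey F (0 + K))) (W : ℕ → ℝ) (shA shB : ℕ → ℝ → (Σ K, SiteSeqKey F (0 + K)) → ℝ) (Wsh δ : ℕ → ℝ),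
            RelWeightBound 1 (classSetK₁₃ θ 0 g₀ (kr F θ h.toCore g₀ os)) (weightAK₁₃ θ h.toCore 0 g₀ os (kr F θ h.toCore g₀ os))
                (weightBK₁₃ θ h.toCore 0 g₀ os (kr F θ h.toCore g₀ os)) Bad W ∧
              ShellWeightBound 1 (classSetK₁₃ θ 0 g₀ (kr F θ h.toCore g₀ os)) (weightAK₁₃ θ h.toCore 0 g₀ os (kr F θ h.toCore g₀ os))
                (weightBK₁₃ θ h.toCore 0 g₀ os (kr F θ h.toCore g₀ os)) shA shB Wsh ∧
              NE7.Core 1 ((F.side : ℝ) ^ 4) (classSetK₁₃ θ 0 g₀ (kr F θ h.toCore g₀ os)) Bad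
                (fun K t u => weightAK₁₃ θ h.toCore 0 g₀ os (kr F θ h.toCore g₀ os) K t u - shA K t u)
                (fun K t u => weightBK₁₃ θ h.toCore 0 g₀ os (kr F θ h.toCore g₀ os) K t u - shB K t u) δ ∧
              Summable δ) :
    Summit.QuantumFields.YangMills.Theses.BalabanUVNodes.SpineGivenEndpointR13SepCoPHV := by
  intro F θ h v hG hθ hB hE
  obtain ⟨hsel, hζm⟩ := hlive F θ h.toCore hG hθ
  refine hybridNE7Under_of_spineNodes_tail (datumOfRecord₁₃SepCoPHV F 2 θ h v) fun hB' hE' => ?_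
  refine ((hF F θ h v hG hθ hB' hE').and
    (keyedExtraction_crOfRecord₁₃KAt_slot_abs 0 kr (fun _ _ _ _ _ _ _ => False) (fun _ _ _ _ _ => (fun _ _ _ => 0, fun _ _ _ => 0)) θ h v
      (EOfRecord₁₃ F 2 θ.toStage13Params) hsel hζm)).mono fun g₀ hg os => ?_
  letI : DecidableEq (Σ K, SiteSeqKey F (0 + K)) := Classical.decEq _
  obtain ⟨Bad, W, shA, shB, Wsh, δ, h20, h21, h19, hδ⟩ := hg.1 os
  obtain ⟨-, -, hE1, hE2⟩ := hg.2 os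
  exact ⟨_, Classical.decEq _, 1, (F.side : ℝ) ^ 4, 0, classSetK₁₃ θ 0 g₀ (kr F θ h.toCore g₀ os), weightAK₁₃ θ h.toCore 0 g₀ os (kr F θ h.toCore g₀ os),
    weightBK₁₃ θ h.toCore 0 g₀ os (kr F θ h.toCore g₀ os), shA, shB, Bad, W, Wsh, δ, one_pos, pow_pos F.side_pos 4, h20, h21, h19, hδ, hE1, hE2⟩

end Socket

/-! ## §2 The three currencies of the lineage, read in the window: certificate (13W), the ℓ¹ letter (13V), the (YG)+(AC) pair (13W §3) -/

section Currencies

/-- **★★ K3⁸ BY NAME FROM THE KEYED LIVE LINE AND A HYBRID CERTIFICATE AT THE `kr`-COARSE CARRIERS, ASKED ONLY UNDER THE PREFIX** (module 13W's `hH`, now per slot tuple, (B) ∕ END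
in hand, inside the window; its `weight ∕ shell ∕ core ∕ summable` fields are §1's faces — the `lt_one` field is not even read). [cite: King1986, (3.10)–(3.13) pp.656–657 (template only)]
[bookkeeping] -/
theorem spineGivenEndpointR13SepCoPHV_of_liveLine_of_fscKeyedHybridNE7K
    (hlive : ∀ (F : T4Family) (θ : Stage13HParams F 2), θ.Provisos₁₃CoPH F 2 → (θ.ZhUnity F 2 ∧ θ.SlotsNondegenerate₁₃ F 2) → θ.Admissible F 2 →
      LiveSel F θ ∧ ZetaMeasurable F 2 θ.ζ)
    (hH : ∀ (F : T4Family) (θ : Stage13HParams F 2) (h : θ.Provisos₁₃SepCoPH F 2) (v : Revision₁₃ F 2 θ h), (θ.ZhUnity F 2 ∧ θ.SlotsNondegenerate₁₃ F 2) → θ.Admissible F 2 →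
      B16.EndStatementBPrinted (datumOfRecord₁₃SepCoPHV F 2 θ h v).C → DagBinding.EndpointExistence (datumOfRecord₁₃SepCoPHV F 2 θ h v).C.toB12 →
        ForSmallCouplings (datumOfRecord₁₃SepCoPHV F 2 θ h v) fun g₀ => ∀ os : List (ULoop F),
          letI : DecidableEq (Σ K, SiteSeqKey F (0 + K)) := Classical.decEq _
          ∃ (Bad : ℕ → ℝ → Finset (Σ K, SiteSeqKey F (0 + K))) (W : ℕ → ℝ) (shA shB : ℕ → ℝ → (Σ K, SiteSeqKey F (0 + K)) → ℝ) (Wsh δ : ℕ → ℝ),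
            HybridNE7 1 ((F.side : ℝ) ^ 4) (classSetK₁₃ θ 0 g₀ (kr F θ h.toCore g₀ os)) (weightAK₁₃ θ h.toCore 0 g₀ os (kr F θ h.toCore g₀ os))
              (weightBK₁₃ θ h.toCore 0 g₀ os (kr F θ h.toCore g₀ os)) Bad W shA shB Wsh δ) :
    Summit.QuantumFields.YangMills.Theses.BalabanUVNodes.SpineGivenEndpointR13SepCoPHV := by
  refine spineGivenEndpointR13SepCoPHV_of_liveLine_of_fscFacesK kr hlive fun F θ h v hG hθ hB hE => ?_
  refine (hH F θ h v hG hθ hB hE).mono fun g₀ hg os => ?_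
  letI : DecidableEq (Σ K, SiteSeqKey F (0 + K)) := Classical.decEq _
  obtain ⟨Bad, W, shA, shB, Wsh, δ, hHy⟩ := hg os
  exact ⟨Bad, W, shA, shB, Wsh, δ, hHy.weight, hHy.shell, hHy.core, hHy.summable⟩

/-- **★★★ K3⁸ BY NAME FROM THE KEYED LIVE LINE AND THE ONE ℓ¹ LETTER AT `kr`, ASKED ONLY UNDER THE PREFIX** — module 13V's «summable one-sided ℓ¹ class-matching modulo constants of the
two runs' `kr`-coarse class weights», now per slot tuple, (B) ∕ END in hand, for the tuned `g₀` only: per `os` SOME constants `c` and summable `w ≥ 0` carry the two letters.  Faces: empty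
bad class (weight `0`), module 13's ℓ¹-optimal shells (`shellWeightBound_optShell`) and `core_optShell_zero` (`δ = 0`) on the non-negative coarse weights (13K).  NOT a proof of K3⁸
(`proof.conditional`). [cite: Balaban1989LargeFieldII, (1.80) p.384; Balaban1987RG1, Thm 2 p.259 (templates only)] [bookkeeping] -/
theorem spineGivenEndpointR13SepCoPHV_of_liveLine_of_fscL1LetterK
    (hlive : ∀ (F : T4Family) (θ : Stage13HParams F 2), θ.Provisos₁₃CoPH F 2 → (θ.ZhUnity F 2 ∧ θ.SlotsNondegenerate₁₃ F 2) → θ.Admissible F 2 →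
      LiveSel F θ ∧ ZetaMeasurable F 2 θ.ζ)
    (hW : ∀ (F : T4Family) (θ : Stage13HParams F 2) (h : θ.Provisos₁₃SepCoPH F 2) (v : Revision₁₃ F 2 θ h), (θ.ZhUnity F 2 ∧ θ.SlotsNondegenerate₁₃ F 2) → θ.Admissible F 2 →
      B16.EndStatementBPrinted (datumOfRecord₁₃SepCoPHV F 2 θ h v).C → DagBinding.EndpointExistence (datumOfRecord₁₃SepCoPHV F 2 θ h v).C.toB12 →
        ForSmallCouplings (datumOfRecord₁₃SepCoPHV F 2 θ h v) fun g₀ => ∀ os : List (ULoop F), ∃ c w : ℕ → ℝ, (∀ K, 0 ≤ w K) ∧ Summable w ∧ ∀ (K : ℕ) (t : ℝ), |t| ≤ 1 →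
          (∑ u ∈ classSetK₁₃ θ 0 g₀ (kr F θ h.toCore g₀ os) K,
              max 0 (weightAK₁₃ θ h.toCore 0 g₀ os (kr F θ h.toCore g₀ os) K t u - Real.exp (-c K) * weightBK₁₃ θ h.toCore 0 g₀ os (kr F θ h.toCore g₀ os) K t u)
            ≤ w K * ∑ u ∈ classSetK₁₃ θ 0 g₀ (kr F θ h.toCore g₀ os) K, weightAK₁₃ θ h.toCore 0 g₀ os (kr F θ h.toCore g₀ os) K t u) ∧
          (∑ u ∈ classSetK₁₃ θ 0 g₀ (kr F θ h.toCore g₀ os) K,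
              max 0 (weightBK₁₃ θ h.toCore 0 g₀ os (kr F θ h.toCore g₀ os) K t u - Real.exp (c K) * weightAK₁₃ θ h.toCore 0 g₀ os (kr F θ h.toCore g₀ os) K t u)
            ≤ w K * ∑ u ∈ classSetK₁₃ θ 0 g₀ (kr F θ h.toCore g₀ os) K, weightBK₁₃ θ h.toCore 0 g₀ os (kr F θ h.toCore g₀ os) K t u)) :
    Summit.QuantumFields.YangMills.Theses.BalabanUVNodes.SpineGivenEndpointR13SepCoPHV := by
  refine spineGivenEndpointR13SepCoPHV_of_liveLine_of_fscFacesK kr hlive fun F θ h v hG hθ hB hE => ?_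
  refine (hW F θ h v hG hθ hB hE).mono fun g₀ hg os => ?_
  letI : DecidableEq (Σ K, SiteSeqKey F (0 + K)) := Classical.decEq _
  obtain ⟨c, w, hw0, hws, hl⟩ := hg os
  have hA := weightAK₁₃_nonneg_record 0 kr θ h.toCore g₀ os
  have hB := weightBK₁₃_nonneg_record 0 kr θ h.toCore g₀ os
  refine ⟨fun _ _ => ∅, fun _ => 0, _, _, w, fun _ => 0, ?_,
    shellWeightBound_optShell (l₀ := 1) (T := classSetK₁₃ θ 0 g₀ (kr F θ h.toCore g₀ os)) _ _ c (fun K t _ u _ => hA K t u) (fun K t _ u _ => hB K t u) hw0 hws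
      (fun K t ht => (hl K t ht).1) (fun K t ht => (hl K t ht).2),
    core_optShell_zero (l₀ := 1) (T := classSetK₁₃ θ 0 g₀ (kr F θ h.toCore g₀ os)) (Bad := fun _ _ => ∅) _ _ c (fun K t _ u _ => hA K t u) (fun K t _ u _ => hB K t u),
    summable_zero⟩
  -- N20 at the empty bad class: the zero witness
  exact
    { bad_subset := fun _ _ _ => Finset.empty_subset _
      nonneg := fun _ => le_rfl
      lt_one := fun _ => zero_lt_one
      summable := summable_zero
      bad_left := fun _ _ _ => by simp
      bad_right := fun _ _ _ => by simp }

variable (bd : BadKeyReading₁₃ 2 0)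

/-- **★★ K3⁸ BY NAME FROM THE KEYED LIVE LINE AND THE WINDOW-KEY-CORE CARD's TWO LETTERS AT `kr`, ASKED ONLY UNDER THE PREFIX** — 13W §3's (YGₖᵣ) zero-shell core letter on the
good coarse classes of the bad-key reading `bd` + (ACₖᵣ) `RelWeightBound` witness on its bad classes, now per slot tuple, (B) ∕ END in hand, for the tuned `g₀` only (the tree's
`hybridNE7_noShell`, then §2's certificate road).  NOT a proof of K3⁸ (`proof.conditional`). [cite: Balaban1989LargeFieldII, (1.80) p.384 (the pending window; template only)] [bookkeeping] -/
theorem spineGivenEndpointR13SepCoPHV_of_liveLine_of_fscCoreLetterK_of_relWeightBoundK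
    (hlive : ∀ (F : T4Family) (θ : Stage13HParams F 2), θ.Provisos₁₃CoPH F 2 → (θ.ZhUnity F 2 ∧ θ.SlotsNondegenerate₁₃ F 2) → θ.Admissible F 2 →
      LiveSel F θ ∧ ZetaMeasurable F 2 θ.ζ)
    (hAC : ∀ (F : T4Family) (θ : Stage13HParams F 2) (h : θ.Provisos₁₃SepCoPH F 2) (v : Revision₁₃ F 2 θ h), (θ.ZhUnity F 2 ∧ θ.SlotsNondegenerate₁₃ F 2) → θ.Admissible F 2 →
      B16.EndStatementBPrinted (datumOfRecord₁₃SepCoPHV F 2 θ h v).C → DagBinding.EndpointExistence (datumOfRecord₁₃SepCoPHV F 2 θ h v).C.toB12 →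
        ForSmallCouplings (datumOfRecord₁₃SepCoPHV F 2 θ h v) fun g₀ => ∀ os : List (ULoop F),
          letI : DecidableEq (Σ K, SiteSeqKey F (0 + K)) := Classical.decEq _
          ∃ W δ : ℕ → ℝ,
            RelWeightBound 1 (classSetK₁₃ θ 0 g₀ (kr F θ h.toCore g₀ os)) (weightAK₁₃ θ h.toCore 0 g₀ os (kr F θ h.toCore g₀ os))
                (weightBK₁₃ θ h.toCore 0 g₀ os (kr F θ h.toCore g₀ os)) (badClassK₁₃ θ 0 g₀ (kr F θ h.toCore g₀ os) (bd F θ h.toCore g₀ os)) W ∧ Summable δ ∧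
            ∀ K : ℕ, ∃ c : ℝ, ∀ t : ℝ, |t| ≤ 1 →
              ∀ u ∈ classSetK₁₃ θ 0 g₀ (kr F θ h.toCore g₀ os) K \ badClassK₁₃ θ 0 g₀ (kr F θ h.toCore g₀ os) (bd F θ h.toCore g₀ os) K t,
                Real.exp (c - (F.side : ℝ) ^ 4 * δ K) * weightAK₁₃ θ h.toCore 0 g₀ os (kr F θ h.toCore g₀ os) K t u ≤ weightBK₁₃ θ h.toCore 0 g₀ os (kr F θ h.toCore g₀ os) K t u ∧
                weightBK₁₃ θ h.toCore 0 g₀ os (kr F θ h.toCore g₀ os) K t u ≤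
                  Real.exp (c + (F.side : ℝ) ^ 4 * δ K) * weightAK₁₃ θ h.toCore 0 g₀ os (kr F θ h.toCore g₀ os) K t u) :
    Summit.QuantumFields.YangMills.Theses.BalabanUVNodes.SpineGivenEndpointR13SepCoPHV := by
  refine spineGivenEndpointR13SepCoPHV_of_liveLine_of_fscKeyedHybridNE7K kr hlive fun F θ h v hG hθ hB hE => ?_
  refine (hAC F θ h v hG hθ hB hE).mono fun g₀ hg os => ?_
  letI : DecidableEq (Σ K, SiteSeqKey F (0 + K)) := Classical.decEq _
  obtain ⟨W, δ, hW, hδ, hgood⟩ := hg os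
  exact ⟨_, W, _, _, _, δ, hybridNE7_noShell hW
    (fun K t _ u _ => weightAK₁₃_nonneg_record 0 kr θ h.toCore g₀ os K t u) (fun K t _ u _ => weightBK₁₃_nonneg_record 0 kr θ h.toCore g₀ os K t u) hδ hgood⟩

end Currencies

end Summit.QuantumFields.YangMills.BalabanUVNodes.N20KeyReadingRoadUnderPrefix

end
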